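import Summits.CriticalPhenomena.CardyFormulaZ2.Theorems.CardyBoundaryCoulombGasStripClusterRatesStubComposeOne

/-!
# Stub `co_cardyOrderOne_of_rectCardyOne` (S3) of line `two-cluster-rate-is-stationary-gap`,
crux `StripClusterRates` (reshape 6, lead c7)

Cardy's value for the lattice rectangles (RC₁) implies the Cardy-order one-cluster bound (CO₁).

Notation: `p₁(m, n) = crossingProb half m n` is the probability of an open left-right crossing of
`[0, m] × [0, n]` in bond percolation on `ℤ²` at `p = 1/2`; `λ = KlebanZagier.lamR` is the modulus of
the corner-marked rectangle of aspect `t`; `F = RandomPlanarGeometry.cardyFunction` is Cardy's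
function; `P_A = F(λ(A))`.

Hypotheses (landed / registered elsewhere, taken verbatim):
* (B) `log λ(t)/t → −π`;
* (C) `log F(η)/log η → 1/3` as `η → 0⁺`;
* (R) RC₁: `p₁(A k − 2, k − 2) → P_A` for every integer aspect `A ≥ 1`.

Conclusion CO₁: there are `g, G : ℕ → ℝ` with `g(A)/A → π/3`, `G(A)/A → π/3` and, for every
`A ≥ 1`, eventually in `n`: `e^{−G(A)} ≤ p₁(A n, n) ≤ e^{−g(A)}`.

Proof. `P_A > 0` (`g_cardy_lamR_pos`). Re-index (R) along `k = n + 2`: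
`p₁(A(n+2) − 2, n) → P_A`. LOWER: `A n ≤ A(n+2) − 2`, so by width-antitonicity
(`crossingProb_anti_left`) `p₁(A n, n) ≥ p₁(A(n+2) − 2, n) ≥ P_A/2` eventually; take
`G(A) = log 2 − log P_A`, so `e^{−G(A)} = P_A/2`, and `G(A)/A → π/3` by `g_tendsto_cA_div`
(`−log P_A / A → π/3`) plus `log 2 / A → 0`. UPPER: for `A = B + 1 ≥ 2` and `n ≥ 2B`,
`B(n+2) − 2 ≤ A n`, so `p₁(A n, n) ≤ p₁(B(n+2) − 2, n) ≤ 2 P_B` eventually; take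
`g(A) = −(log 2 + log P_{A−1})` for `A ≥ 2` and `g(1) = 0` (`p₁ ≤ 1`); `g(A)/A → π/3` by shifting
the index in `g_tendsto_cA_div` and `(A − 1)/A → 1`.
-/

noncomputable section
open MeasureTheory Filter Topology Set
open Literature.Probability.LatticeModels Literature.Probability.Percolation
open Literature.Probability.RandomPlanarGeometry (cardyFunction)
open Literature.Probability.RandomPlanarGeometry.KlebanZagier (lamR lamR_mem_Ioo tendsto_lamR_atTop)

namespace Summit.CriticalPhenomena.CardyFormulaZ2.Cruxes.StripClusterRates.TwoClusterRateIsStationaryGap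

/-! ## Small helpers

(`cardyFunction` is written fully qualified below: the short name is ambiguous between
`RandomPlanarGeometry.cardyFunction` — the one in the registered statement — and
`Percolation.cardyFunction`.) -/

/-- Re-indexing RC₁ along `k = n + 2`: `p₁(A(n+2) − 2, n) → P`. -/
theorem co1r_tendsto_reindex {A : ℕ} {P : ℝ}
    (hR : Tendsto (fun k : ℕ ↦ crossingProb half (A * k - 2) (k - 2)) atTop (𝓝 P)) :
    Tendsto (fun n : ℕ ↦ crossingProb half (A * (n + 2) - 2) n) atTop (𝓝 P) := by
  have := hR.comp (tendsto_add_atTop_nat 2)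
  refine this.congr' (Eventually.of_forall fun n ↦ ?_)
  simp only [Function.comp_apply, Nat.add_sub_cancel]

/-- Lower index inequality: `A n ≤ A(n+2) − 2` for `A ≥ 1`. -/
theorem co1r_le_lower {A : ℕ} (hA : 1 ≤ A) (n : ℕ) : A * n ≤ A * (n + 2) - 2 := by
  have h : A * (n + 2) = A * n + 2 * A := by ring
  omega

/-- Upper index inequality: `B(n+2) − 2 ≤ (B+1) n` for `n + 2 ≥ 2B`. -/
theorem co1r_le_upper {B n : ℕ} (hn : 2 * B ≤ n + 2) : B * (n + 2) - 2 ≤ (B + 1) * n := by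
  have h1 : B * (n + 2) = B * n + 2 * B := by ring
  have h2 : (B + 1) * n = B * n + n := by ring
  omega

/-- `(A − 1)/A → 1` along the naturals (with natural subtraction). -/
theorem co1r_tendsto_pred_div : Tendsto (fun A : ℕ ↦ ((A - 1 : ℕ) : ℝ) / (A : ℝ)) atTop (𝓝 1) := by
  have h1 : Tendsto (fun A : ℕ ↦ (1 : ℝ) - (A : ℝ)⁻¹) atTop (𝓝 (1 - 0)) :=
    tendsto_const_nhds.sub tendsto_inv_atTop_nhds_zero_nat
  rw [sub_zero] at h1
  refine h1.congr' ?_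
  filter_upwards [eventually_ge_atTop 1] with A hA
  have hA0 : (A : ℝ) ≠ 0 := Nat.cast_ne_zero.mpr (by omega)
  rw [Nat.cast_sub hA, Nat.cast_one, sub_div, div_self hA0, inv_eq_one_div]

/-- **Limit of the upper constants**: `−(log 2 + log P_{A−1})/A → π/3`. -/
theorem co1r_tendsto_g
    (hB : Tendsto (fun t : ℝ ↦ Real.log (lamR t) / t) atTop (𝓝 (-Real.pi)))
    (hC : Tendsto (fun η : ℝ ↦
      Real.log (Literature.Probability.RandomPlanarGeometry.cardyFunction η) / Real.log η)
      (𝓝[>] 0) (𝓝 (1 / 3 : ℝ))) :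
    Tendsto (fun A : ℕ ↦ (if A ≤ 1 then (0 : ℝ) else -(Real.log 2 +
      Real.log (Literature.Probability.RandomPlanarGeometry.cardyFunction (lamR ((A - 1 : ℕ) : ℝ)))))
        / (A : ℝ)) atTop (𝓝 (Real.pi / 3)) := by
  have hc1 : Tendsto (fun A : ℕ ↦
      -Real.log (Literature.Probability.RandomPlanarGeometry.cardyFunction (lamR ((A - 1 : ℕ) : ℝ)))
        / ((A - 1 : ℕ) : ℝ)) atTop (𝓝 (Real.pi / 3)) :=
    (g_tendsto_cA_div hB hC).comp (tendsto_sub_atTop_nat 1)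
  have h2 : Tendsto (fun A : ℕ ↦ -Real.log 2 / (A : ℝ)) atTop (𝓝 0) :=
    tendsto_const_div_atTop_nhds_zero_nat _
  have hsum := h2.add (hc1.mul co1r_tendsto_pred_div)
  rw [mul_one, zero_add] at hsum
  refine hsum.congr' ?_
  filter_upwards [eventually_ge_atTop 2] with A hA
  rw [if_neg (show ¬ A ≤ 1 by omega)]
  have hA0 : (A : ℝ) ≠ 0 := Nat.cast_ne_zero.mpr (by omega)
  have hA1 : ((A - 1 : ℕ) : ℝ) ≠ 0 := Nat.cast_ne_zero.mpr (by omega)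
  field_simp
  ring

/-- **Limit of the lower constants**: `(log 2 − log P_A)/A → π/3`. -/
theorem co1r_tendsto_G
    (hB : Tendsto (fun t : ℝ ↦ Real.log (lamR t) / t) atTop (𝓝 (-Real.pi)))
    (hC : Tendsto (fun η : ℝ ↦
      Real.log (Literature.Probability.RandomPlanarGeometry.cardyFunction η) / Real.log η)
      (𝓝[>] 0) (𝓝 (1 / 3 : ℝ))) :
    Tendsto (fun A : ℕ ↦ (Real.log 2 -
      Real.log (Literature.Probability.RandomPlanarGeometry.cardyFunction (lamR A))) / (A : ℝ))
      atTop (𝓝 (Real.pi / 3)) := by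
  have h2 : Tendsto (fun A : ℕ ↦ Real.log 2 / (A : ℝ)) atTop (𝓝 0) :=
    tendsto_const_div_atTop_nhds_zero_nat _
  have hsum := h2.add (g_tendsto_cA_div hB hC)
  rw [zero_add] at hsum
  refine hsum.congr' (Eventually.of_forall fun A ↦ ?_)
  ring

/-! ## The registered stub -/

/-- **S3 — `co_cardyOrderOne_of_rectCardyOne`**: (B) `log λ(t)/t → −π`, (C) `log F(η)/log η → 1/3`
and RC₁ (Cardy's value `F(λ(A))` for the lattice rectangles of integer aspect `A`) imply the
Cardy-order one-cluster bound CO₁: constants `g(A), G(A) ∼ πA/3` with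
`e^{−G(A)} ≤ p₁(A n, n) ≤ e^{−g(A)}` eventually in `n`, for every `A ≥ 1`. [folklore] -/
theorem co_cardyOrderOne_of_rectCardyOne : Tendsto (fun t : ℝ ↦ Real.log (Literature.Probability.RandomPlanarGeometry.KlebanZagier.lamR t) / t) atTop (𝓝 (-Real.pi)) → Tendsto (fun η : ℝ ↦ Real.log (Literature.Probability.RandomPlanarGeometry.cardyFunction η) / Real.log η) (𝓝[>] 0) (𝓝 (1 / 3 : ℝ)) → (∀ A : ℕ, 1 ≤ A → Tendsto (fun k : ℕ ↦ crossingProb half (A * k - 2) (k - 2)) atTop (𝓝 (Literature.Probability.RandomPlanarGeometry.cardyFunction (Literature.Probability.RandomPlanarGeometry.KlebanZagier.lamR A)))) → ∃ g G : ℕ → ℝ, Tendsto (fun A : ℕ ↦ g A / A) atTop (𝓝 (Real.pi / 3)) ∧ Tendsto (fun A : ℕ ↦ G A / A) atTop (𝓝 (Real.pi / 3)) ∧ ∀ A : ℕ, 1 ≤ A → ∀ᶠ n : ℕ in atTop, Real.exp (-G A) ≤ crossingProb half (A * n) n ∧ crossingProb half (A * n) n ≤ Real.exp (-g A) := by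
  intro hB hC hR
  refine ⟨fun A ↦ if A ≤ 1 then (0 : ℝ) else -(Real.log 2 +
      Real.log (Literature.Probability.RandomPlanarGeometry.cardyFunction (lamR ((A - 1 : ℕ) : ℝ)))),
    fun A ↦ Real.log 2 - Real.log (Literature.Probability.RandomPlanarGeometry.cardyFunction (lamR A)),
    co1r_tendsto_g hB hC, co1r_tendsto_G hB hC, ?_⟩
  intro A hA1
  have hApos : (0 : ℝ) < A := Nat.cast_pos.mpr (by omega)
  have hP : 0 < Literature.Probability.RandomPlanarGeometry.cardyFunction (lamR A) :=
    g_cardy_lamR_pos hApos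
  -- lower: eventually `P_A / 2 < p₁(A(n+2) − 2, n)`
  have hlow : ∀ᶠ n : ℕ in atTop, Literature.Probability.RandomPlanarGeometry.cardyFunction (lamR A) / 2
      < crossingProb half (A * (n + 2) - 2) n :=
    (co1r_tendsto_reindex (hR A hA1)).eventually (lt_mem_nhds (by linarith))
  have hGexp : Real.exp (-(Real.log 2 -
      Real.log (Literature.Probability.RandomPlanarGeometry.cardyFunction (lamR A)))) =
      Literature.Probability.RandomPlanarGeometry.cardyFunction (lamR A) / 2 := by
    rw [neg_sub, Real.exp_sub, Real.exp_log hP, Real.exp_log two_pos]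
  obtain rfl | hlt := hA1.eq_or_lt
  · -- `A = 1`: the upper bound is `p₁ ≤ 1 = e^0`
    filter_upwards [hlow] with n hn
    rw [hGexp, if_pos le_rfl, neg_zero, Real.exp_zero]
    exact ⟨hn.le.trans (crossingProb_anti_left half (co1r_le_lower hA1 n) n),
      (crossingProb_mem_Icc half _ _).2⟩
  · -- `A = B + 1 ≥ 2`: compare with the aspect-`B` rectangles of RC₁
    obtain ⟨B, rfl⟩ : ∃ B, A = B + 1 := ⟨A - 1, by omega⟩
    have hB1 : 1 ≤ B := by omega
    have hBpos : (0 : ℝ) < B := Nat.cast_pos.mpr (by omega)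
    have hQ : 0 < Literature.Probability.RandomPlanarGeometry.cardyFunction (lamR B) :=
      g_cardy_lamR_pos hBpos
    have hup : ∀ᶠ n : ℕ in atTop, crossingProb half (B * (n + 2) - 2) n
        < (2 : ℝ) * Literature.Probability.RandomPlanarGeometry.cardyFunction (lamR B) :=
      (co1r_tendsto_reindex (hR B hB1)).eventually (gt_mem_nhds (by linarith))
    filter_upwards [hlow, hup, eventually_ge_atTop (2 * B)] with n hn hn' h2B
    rw [hGexp, if_neg (show ¬ (B + 1 ≤ 1) by omega), Nat.add_sub_cancel, neg_neg, Real.exp_add,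
      Real.exp_log two_pos, Real.exp_log hQ]
    exact ⟨hn.le.trans (crossingProb_anti_left half (co1r_le_lower hA1 n) n),
      (crossingProb_anti_left half (co1r_le_upper (by omega)) n).trans hn'.le⟩

end Summit.CriticalPhenomena.CardyFormulaZ2.Cruxes.StripClusterRates.TwoClusterRateIsStationaryGap

end
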